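import Summits.BirchSwinnertonDyer.Rank1Residual.Additive.XMultRankZeroCyclotomicPrimeCert
import Summits.BirchSwinnertonDyer.Rank1Residual.Additive.X4RankZeroSemistableTwistOddSurj
import Literature.NumberTheory.EllipticCurves.Wuthrich2014.SurjectiveMultiplicativeDivisibilityCyclotomicPrime
import Literature.NumberTheory.EllipticCurves.PAdicHeightsProofs
import HarnessLib

/-!
# X4, (M)-rows at `p ≥ 5`, ranks `(0,0)`, from NAMED FACTS ONLY (line V19b): the additive X4 curve
# `W` (`I_n*`, `ρ̄_{W,p}` surjective) and its multiplicative twist `V = W^{(p*)}`, split or non-split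
# — `BSD(W,p) ∧ BSD(V,p)` on the certified unit rows

HONEST FRAMING (cell `b2b-bsdres`, run/shared/lean/b2b/bsd-rank1-residual/, verbatim in every
file): the goal of the cell is to DELETE the COMBINATION-SHAPED residual classes of the
Birch–Swinnerton-Dyer formula for ALL analytic-rank `≤ 1` elliptic curves over `ℚ` — "full BSD
formula for every rank `≤ 1` curve in class `C`" assembled STRICTLY from published theorems — so
that the rank-`≤ 1` remainder becomes exactly the CONSTRUCTION-SHAPED classes, which are TYPED
(missing-input `Prop`s), NOT attempted. This is not "finishing BSD". Seat additive-p4 (research route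
on X3/X4); the label of X4 is UNCHANGED by this file; nothing is booked here.

Theorems only (no `def`, no `sorry`, no new named fact). Inputs, ALL named published facts or tree
theorems: Kato's divisibility as attributed in Wuthrich 2014 Thm. 3 / Cor. 19 (surjective
`ρ_{V,p^∞}`), multiplicative clauses read over `ℚ(ζ_p)` with all branches
(`Wuthrich2014.kato_charIdeal_dvd_nonsplitMultiplicative_cyclotomicPrime_of_surjective` /
`…splitMultiplicative_cyclotomicPrime_of_surjective`, this gen), Serre's lemma (`p ≥ 5`: `ρ̄_{W,p}`
onto ⇒ `ρ_{V,p^∞}` onto, tree `X4RankZeroTwistOdd.forall_surj_pow_twist_of_surj`), Greenberg LNM 1716 pp. 112–113 displays over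
`F = ℚ(ζ_p)` (`Greenberg1999.thm41Analogue_charValue_rankZero_numberField` / `…_split_baseChange`), the
Greenberg–Stevens derivative (`greenberg_stevens V p`, split rows), Gross–Zagier–Kolyvagin (`hGZK`),
modularity (`hmod`); the `ω⁰`-branch `L` is THE function produced by the tree's existence theorems
(`exists_isMultPAdicLFunctionOf_neg_one_of_nonsplit` / `exists_isSplitMultPAdicLFunctionOf`), the Tate
datum by `nonempty_tateParameterData_iff_holds`. Per pair: the twist datum `C`, the reduction /
image / rank bits, the newform `f` with `ϖ, ϖ'`, the non-vanishing `hO` of the other branch values and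
ONE numerical certificate (census `V19B-CENSUS.tsv`: 21 of the 26 CORE X4 (M)-rows at `p ≥ 5` satisfy
it with both `#Ш_an` units; 3 more reach the typed upper half).
-/

noncomputable section

open scoped Classical MatrixGroups ModularForm

open CongruenceSubgroup WeierstrassCurve NumberField IsDedekindDomain
  Literature.NumberTheory.EllipticCurves Literature.NumberTheory.EllipticCurves.ModularForms
  Literature.NumberTheory.EllipticCurves.Rank1Residual
  Literature.NumberTheory.EllipticCurves.Rank1Residual.Typed
  Literature.NumberTheory.GaloisRepresentations

namespace Summit.BirchSwinnertonDyer.Rank1Residual.Additive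

/-! ## §1 X4, NON-SPLIT twist -/

section Nonsplit

variable (p : ℕ) [hp : Fact p.Prime]
  (V : WeierstrassCurve ℚ) [V.IsElliptic] [V.IsGloballyMinimal]
  (W : WeierstrassCurve ℚ) [W.IsElliptic] [W.IsGloballyMinimal]

/-- **Line V19b for X4, NON-SPLIT twist, from named facts only.** `p ≥ 5`, `V/ℚ` globally minimal
NON-SPLIT multiplicative at `p`, `W = C • V^{(p*)}` globally minimal ADDITIVE at
`p` with `ρ̄_{W,p}` SURJECTIVE (the X4 ∧ (M) situation; `ρ_{V,p^∞}` onto by twist invariance + Serre),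
ranks `(0,0)`; `f` the newform of `V`, `ϖ·Ω_V = Ω⁺_f`,
`ϖ'·|Ω⁻(V)| = Ω⁻_f`; other branch values non-zero. Then `#Ш_an(V) = q_V`, `#Ш_an(W) = q_W` satisfy
the V19b inequality over `F = ℚ(ζ_p) = CyclotomicField p ℚ`, granted EXACTLY: Kato's divisibility as
attributed by Wuthrich Thm. 3 / Cor. 19, non-split clause over `ℚ(ζ_{p^∞})` (`hK`, named fact),
Greenberg's non-split display (`hGr`, named fact), modularity, GZK.
[cite: Wuthrich2014, Thm. 3 (p. 383), Cor. 19 (pp. 398–399)] [cite: GreenbergLNM1716, §4 pp. 112–113]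
[cite: SerreAbelianLadic1968, Ch. IV §3.4, Lemma 3] -/
theorem X4NonsplitMultCyclotomicPrime.exists_padicVal_shaOrder_add_le_of_facts
    (hK : Wuthrich2014.kato_charIdeal_dvd_nonsplitMultiplicative_cyclotomicPrime_of_surjective)
    (hGr : Greenberg1999.thm41Analogue_charValue_rankZero_numberField)
    (hGZK : rank_eq_analyticRank_of_analyticRank_le_one) (hmod : hasEntireLFunction_rat)
    (hp5 : 5 ≤ p) (C : VariableChange ℚ) (hC : C • V.quadraticTwist ((-1 : ℚ) ^ (p / 2) * p) = W)
    (hmult : V.HasMultiplicativeReductionAtPrime p) (hns : ¬ V.HasSplitMultiplicativeReductionAtPrime p)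
    (hsurj : Surj W p) (hadd : Addv W p)
    (hrV : V.analyticRank = 0) (hrW : W.analyticRank = 0)
    {N : ℕ} [NeZero N] {f : CuspForm (Gamma0 N) 2} (hf : IsNewformOf V f)
    (ϖ ϖ' : ℚ) (hϖ : (ϖ : ℝ) * V.realPeriodRat = plusPeriod f)
    (hϖ' : (ϖ' : ℝ) * V.imaginaryPeriodRat = minusPeriod f)
    (hO : (∏ i ∈ (Finset.Ico 1 (p - 1)).erase (p / 2),
        PowerSeries.constantCoeff
          (if Even i then padicLFunctionPlusBranchMult f (-1 : ℚ_[p]) i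
            else padicLFunctionMinusBranchMult f (-1 : ℚ_[p]) i)) ≠ 0) :
    ∃ qV qW : ℚ, shaAn V = (qV : ℂ) ∧ shaAn W = (qW : ℂ) ∧
      (padicValNat p V.shaOrder : ℤ) + padicValNat p W.shaOrder +
          (padicValNat p (V.baseChange (CyclotomicField p ℚ)).tamagawaProduct +
            2 * (padicValNat p (Nat.card V.toAffine.Point) + padicValNat p (Nat.card W.toAffine.Point))) ≤
        padicValRat p qV + padicValRat p qW +
          (padicValNat p V.tamagawaProduct + padicValNat p W.tamagawaProduct +
          2 * padicValNat p (Nat.card (V.baseChange (CyclotomicField p ℚ)).toAffine.Point) +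
          (∏ i ∈ (Finset.Ico 1 (p - 1)).erase (p / 2),
              PowerSeries.constantCoeff
                (if Even i then padicLFunctionPlusBranchMult f (-1 : ℚ_[p]) i
                  else padicLFunctionMinusBranchMult f (-1 : ℚ_[p]) i)).valuation +
          ((p / 2 : ℕ) : ℤ) * (padicValRat p ϖ + padicValRat p ϖ') - padicValRat p ϖ -
          (if p % 4 = 1 then padicValRat p ϖ else padicValRat p ϖ')) := by
  haveI : IsCyclotomicExtension {p} ℚ (CyclotomicField p ℚ) := CyclotomicField.isCyclotomicExtension p ℚ
  haveI : (V.baseChange (CyclotomicField p ℚ)).IsElliptic := by rw [baseChange]; infer_instance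
  have hp2 : p ≠ 2 := by omega
  have hd : ((-1 : ℚ) ^ (p / 2) * p) ≠ 0 :=
    mul_ne_zero (pow_ne_zero _ (by norm_num)) (Nat.cast_ne_zero.mpr hp.out.ne_zero)
  have hsurjV : ∀ n : ℕ, V.HasSurjectiveModNGaloisRep (p ^ n : ℕ) :=
    X4RankZeroTwistOdd.forall_surj_pow_twist_of_surj W p hp5 V hd C hC hsurj
  obtain ⟨L, hL⟩ := exists_isMultPAdicLFunctionOf_neg_one_of_nonsplit (p := p) hf hmult hns
  exact XNonsplitMultCyclotomicPrime.exists_padicVal_shaOrder_add_le_of_greenberg p V W hGr hGZK hmod hp2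
    C hC hmult hns hadd hrV hrW hf ϖ ϖ' hϖ hϖ' L hL
    (fun κ γ hκ hγ hγ' D ↦ hK p V (CyclotomicField p ℚ) (V.baseChange (CyclotomicField p ℚ)) hp2 hmult
      hns hsurjV ⟨1, one_smul _ _⟩ hκ hγ hγ' hf D ϖ ϖ' hϖ hϖ' L hL) hO

/-- **X4 (M), non-split twist: `BSD(W,p) ∧ BSD(V,p)` on the certified unit rows, from named facts
only.** In the situation of `…exists_padicVal_shaOrder_add_le_of_facts`, if `#Ш_an(V)`, `#Ш_an(W)`
are `p`-adic units and ONE numerical certificate holds — `ord_p∏c(V) + ord_p∏c(W) +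
2 ord_p#V(ℚ(ζ_p)) + [v(o) + m(ord_p ϖ + ord_p ϖ') − ord_p ϖ − ord_p ϖ_mid] ≤ 2(ord_p#V(ℚ) + ord_p#W(ℚ))
+ ord_p∏_w c_w(V_{ℚ(ζ_p)})` — then Miller's `BSD(W,p)` and `BSD(V,p)` hold, for the ADDITIVE X4 pair
`(W,p)` (`I_n*`, `ρ̄_{W,p}` onto, `p ≥ 5`) and its non-split multiplicative twist simultaneously.
Census (this gen, `V19B-CENSUS.tsv`): 15 of the 16 CORE X4 (M)-rows at `p ≥ 5` with non-split twist
(all Tamagawa-obstructed for Kim's bound; the certificate spends `ord_p ∏_w c_w(V_F)`). Labels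
UNCHANGED; nothing booked.
[cite: Wuthrich2014, Thm. 3 (p. 383), Cor. 19 (pp. 398–399)] [cite: GreenbergLNM1716, §4 pp. 112–113]
[cite: Miller2011LMS, §1 and Def. 1.1] -/
theorem X4NonsplitMultCyclotomicPrime.bsdp_of_certificate_of_facts
    (hK : Wuthrich2014.kato_charIdeal_dvd_nonsplitMultiplicative_cyclotomicPrime_of_surjective)
    (hGr : Greenberg1999.thm41Analogue_charValue_rankZero_numberField)
    (hGZK : rank_eq_analyticRank_of_analyticRank_le_one) (hmod : hasEntireLFunction_rat)
    (hp5 : 5 ≤ p) (C : VariableChange ℚ) (hC : C • V.quadraticTwist ((-1 : ℚ) ^ (p / 2) * p) = W)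
    (hmult : V.HasMultiplicativeReductionAtPrime p) (hns : ¬ V.HasSplitMultiplicativeReductionAtPrime p)
    (hsurj : Surj W p) (hadd : Addv W p)
    (hrV : V.analyticRank = 0) (hrW : W.analyticRank = 0)
    {N : ℕ} [NeZero N] {f : CuspForm (Gamma0 N) 2} (hf : IsNewformOf V f)
    (ϖ ϖ' : ℚ) (hϖ : (ϖ : ℝ) * V.realPeriodRat = plusPeriod f)
    (hϖ' : (ϖ' : ℝ) * V.imaginaryPeriodRat = minusPeriod f)
    (hO : (∏ i ∈ (Finset.Ico 1 (p - 1)).erase (p / 2),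
        PowerSeries.constantCoeff
          (if Even i then padicLFunctionPlusBranchMult f (-1 : ℚ_[p]) i
            else padicLFunctionMinusBranchMult f (-1 : ℚ_[p]) i)) ≠ 0)
    (hcert : (padicValNat p V.tamagawaProduct : ℤ) + padicValNat p W.tamagawaProduct +
          2 * padicValNat p (Nat.card (V.baseChange (CyclotomicField p ℚ)).toAffine.Point) +
          (∏ i ∈ (Finset.Ico 1 (p - 1)).erase (p / 2),
              PowerSeries.constantCoeff
                (if Even i then padicLFunctionPlusBranchMult f (-1 : ℚ_[p]) i
                  else padicLFunctionMinusBranchMult f (-1 : ℚ_[p]) i)).valuation +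
          ((p / 2 : ℕ) : ℤ) * (padicValRat p ϖ + padicValRat p ϖ') - padicValRat p ϖ -
          (if p % 4 = 1 then padicValRat p ϖ else padicValRat p ϖ') ≤
        padicValNat p (V.baseChange (CyclotomicField p ℚ)).tamagawaProduct +
          2 * (padicValNat p (Nat.card V.toAffine.Point) + padicValNat p (Nat.card W.toAffine.Point)))
    {qV qW : ℚ} (hqV : shaAn V = (qV : ℂ)) (hqW : shaAn W = (qW : ℂ))
    (hvV : padicValRat p qV = 0) (hvW : padicValRat p qW = 0) : BSDp W p ∧ BSDp V p :=
  XMultCyclotomicPrime.bsdp_of_ineq p V W hGZK hrV hrW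
    (X4NonsplitMultCyclotomicPrime.exists_padicVal_shaOrder_add_le_of_facts p V W hK hGr hGZK hmod hp5 C hC
      hmult hns hsurj hadd hrV hrW hf ϖ ϖ' hϖ hϖ' hO) hcert hqV hqW hvV hvW

/-- **X4 (M), non-split twist: the typed UPPER half `ord_p #Ш(W) ≤ ord_p #Ш_an(W)` for the additive
curve** from the same facts and certificate when `p ∤ #Ш_an(V)` (`Typed.MissingUpperBoundAt W p`).
[cite: Wuthrich2014, Thm. 3 (p. 383), Cor. 19 (pp. 398–399)] [cite: GreenbergLNM1716, §4 pp. 112–113] -/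
theorem X4NonsplitMultCyclotomicPrime.missingUpperBoundAt_of_certificate_of_facts
    (hK : Wuthrich2014.kato_charIdeal_dvd_nonsplitMultiplicative_cyclotomicPrime_of_surjective)
    (hGr : Greenberg1999.thm41Analogue_charValue_rankZero_numberField)
    (hGZK : rank_eq_analyticRank_of_analyticRank_le_one) (hmod : hasEntireLFunction_rat)
    (hp5 : 5 ≤ p) (C : VariableChange ℚ) (hC : C • V.quadraticTwist ((-1 : ℚ) ^ (p / 2) * p) = W)
    (hmult : V.HasMultiplicativeReductionAtPrime p) (hns : ¬ V.HasSplitMultiplicativeReductionAtPrime p)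
    (hsurj : Surj W p) (hadd : Addv W p)
    (hrV : V.analyticRank = 0) (hrW : W.analyticRank = 0)
    {N : ℕ} [NeZero N] {f : CuspForm (Gamma0 N) 2} (hf : IsNewformOf V f)
    (ϖ ϖ' : ℚ) (hϖ : (ϖ : ℝ) * V.realPeriodRat = plusPeriod f)
    (hϖ' : (ϖ' : ℝ) * V.imaginaryPeriodRat = minusPeriod f)
    (hO : (∏ i ∈ (Finset.Ico 1 (p - 1)).erase (p / 2),
        PowerSeries.constantCoeff
          (if Even i then padicLFunctionPlusBranchMult f (-1 : ℚ_[p]) i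
            else padicLFunctionMinusBranchMult f (-1 : ℚ_[p]) i)) ≠ 0)
    (hcert : (padicValNat p V.tamagawaProduct : ℤ) + padicValNat p W.tamagawaProduct +
          2 * padicValNat p (Nat.card (V.baseChange (CyclotomicField p ℚ)).toAffine.Point) +
          (∏ i ∈ (Finset.Ico 1 (p - 1)).erase (p / 2),
              PowerSeries.constantCoeff
                (if Even i then padicLFunctionPlusBranchMult f (-1 : ℚ_[p]) i
                  else padicLFunctionMinusBranchMult f (-1 : ℚ_[p]) i)).valuation +
          ((p / 2 : ℕ) : ℤ) * (padicValRat p ϖ + padicValRat p ϖ') - padicValRat p ϖ -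
          (if p % 4 = 1 then padicValRat p ϖ else padicValRat p ϖ') ≤
        padicValNat p (V.baseChange (CyclotomicField p ℚ)).tamagawaProduct +
          2 * (padicValNat p (Nat.card V.toAffine.Point) + padicValNat p (Nat.card W.toAffine.Point)))
    {qV : ℚ} (hqV : shaAn V = (qV : ℂ)) (hvV : padicValRat p qV ≤ 0) : MissingUpperBoundAt W p := by
  haveI : Finite V.sha := (hGZK V (by rw [hrV]; exact zero_le_one)).2
  exact XMultCyclotomicPrime.missingUpperBoundAt_of_ineq p V W
    (X4NonsplitMultCyclotomicPrime.exists_padicVal_shaOrder_add_le_of_facts p V W hK hGr hGZK hmod hp5 C hC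
      hmult hns hsurj hadd hrV hrW hf ϖ ϖ' hϖ hϖ' hO) hcert hqV hvV

/-- **X4 (M), non-split twist, `p ∣ #Ш_an(W)` rows: `BSD(W,p)`** from the same facts and certificate,
`p ∤ #Ш_an(V)`, Cassels–Tate squareness (`hCT`) and ONE `p`-descent certificate
`p^{2k−1} ∣ #Ш(W)` with `ord_p #Ш_an(W) ≤ 2k` (census: `19600by1` at `p = 5`, `#Ш_an(W) = 25`, `k = 1`).
[cite: Wuthrich2014, Thm. 3 (p. 383), Cor. 19 (pp. 398–399)] [cite: SilvermanAEC2009, Thm. X.4.14] -/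
theorem X4NonsplitMultCyclotomicPrime.bsdp_of_casselsTate_of_certificate_of_facts
    (hK : Wuthrich2014.kato_charIdeal_dvd_nonsplitMultiplicative_cyclotomicPrime_of_surjective)
    (hGr : Greenberg1999.thm41Analogue_charValue_rankZero_numberField)
    (hGZK : rank_eq_analyticRank_of_analyticRank_le_one) (hmod : hasEntireLFunction_rat)
    (hCT : exists_casselsTate_pairing (K := ℚ))
    (hp5 : 5 ≤ p) (C : VariableChange ℚ) (hC : C • V.quadraticTwist ((-1 : ℚ) ^ (p / 2) * p) = W)
    (hmult : V.HasMultiplicativeReductionAtPrime p) (hns : ¬ V.HasSplitMultiplicativeReductionAtPrime p)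
    (hsurj : Surj W p) (hadd : Addv W p)
    (hrV : V.analyticRank = 0) (hrW : W.analyticRank = 0)
    {N : ℕ} [NeZero N] {f : CuspForm (Gamma0 N) 2} (hf : IsNewformOf V f)
    (ϖ ϖ' : ℚ) (hϖ : (ϖ : ℝ) * V.realPeriodRat = plusPeriod f)
    (hϖ' : (ϖ' : ℝ) * V.imaginaryPeriodRat = minusPeriod f)
    (hO : (∏ i ∈ (Finset.Ico 1 (p - 1)).erase (p / 2),
        PowerSeries.constantCoeff
          (if Even i then padicLFunctionPlusBranchMult f (-1 : ℚ_[p]) i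
            else padicLFunctionMinusBranchMult f (-1 : ℚ_[p]) i)) ≠ 0)
    (hcert : (padicValNat p V.tamagawaProduct : ℤ) + padicValNat p W.tamagawaProduct +
          2 * padicValNat p (Nat.card (V.baseChange (CyclotomicField p ℚ)).toAffine.Point) +
          (∏ i ∈ (Finset.Ico 1 (p - 1)).erase (p / 2),
              PowerSeries.constantCoeff
                (if Even i then padicLFunctionPlusBranchMult f (-1 : ℚ_[p]) i
                  else padicLFunctionMinusBranchMult f (-1 : ℚ_[p]) i)).valuation +
          ((p / 2 : ℕ) : ℤ) * (padicValRat p ϖ + padicValRat p ϖ') - padicValRat p ϖ -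
          (if p % 4 = 1 then padicValRat p ϖ else padicValRat p ϖ') ≤
        padicValNat p (V.baseChange (CyclotomicField p ℚ)).tamagawaProduct +
          2 * (padicValNat p (Nat.card V.toAffine.Point) + padicValNat p (Nat.card W.toAffine.Point)))
    {qV : ℚ} (hqV : shaAn V = (qV : ℂ)) (hvV : padicValRat p qV ≤ 0)
    {q : ℚ} (hq : shaAn W = (q : ℂ)) {k : ℕ} (hv : padicValRat p q ≤ 2 * k)
    (hdvd : p ^ (2 * k - 1) ∣ W.shaOrder) : BSDp W p :=
  XMultCyclotomicPrime.bsdp_of_casselsTate_of_ineq p V W hGZK hCT hrV hrW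
    (X4NonsplitMultCyclotomicPrime.exists_padicVal_shaOrder_add_le_of_facts p V W hK hGr hGZK hmod hp5 C hC
      hmult hns hsurj hadd hrV hrW hf ϖ ϖ' hϖ hϖ' hO) hcert hqV hvV hq hv hdvd

end Nonsplit

/-! ## §2 X4, SPLIT twist (exceptional zero) -/

section Split

variable (p : ℕ) [hp : Fact p.Prime]
  (V : WeierstrassCurve ℚ) [V.IsElliptic] [V.IsGloballyMinimal]
  (W : WeierstrassCurve ℚ) [W.IsElliptic] [W.IsGloballyMinimal]

/-- **Line V19b for X4, SPLIT twist, from named facts only.** `p ≥ 5`, `V/ℚ` globally minimal SPLIT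
multiplicative at `p`, `W = C • V^{(p*)}` globally minimal ADDITIVE at `p` with `ρ̄_{W,p}` SURJECTIVE,
ranks `(0,0)`; `f` the newform of `V`, `ϖ·Ω_V = Ω⁺_f`, `ϖ'·|Ω⁻(V)| = Ω⁻_f`; other branch values
non-zero. Then `#Ш_an(V) = q_V`, `#Ш_an(W) = q_W` satisfy the V19b inequality over
`F = CyclotomicField p ℚ`, granted EXACTLY: Kato's divisibility as attributed by Wuthrich Thm. 3 /
Cor. 19, split clause (`I · char X ∣ L_p`) over `ℚ(ζ_{p^∞})` (`hK`, named fact), Greenberg's split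
display (`hGr`, named fact), Greenberg–Stevens (`hGS`, named fact), modularity, GZK; the Tate datum and
THE `ω⁰`-branch are produced in the tree.
[cite: Wuthrich2014, Thm. 3 (p. 383), Cor. 19 (pp. 398–399)] [cite: GreenbergLNM1716, §4 pp. 112–113, §3 p. 94]
[cite: Kobayashi2006DocMath, Cor. 4.2 (p. 575)] [cite: SerreAbelianLadic1968, Ch. IV §3.4, Lemma 3] -/
theorem X4SplitMultCyclotomicPrime.exists_padicVal_shaOrder_add_le_of_facts
    (hK : Wuthrich2014.kato_charIdeal_dvd_splitMultiplicative_cyclotomicPrime_of_surjective)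
    (hGr : Greenberg1999.thm41Analogue_charValue_rankZero_split_baseChange) (hGS : greenberg_stevens V p)
    (hGZK : rank_eq_analyticRank_of_analyticRank_le_one) (hmod : hasEntireLFunction_rat)
    (hp5 : 5 ≤ p) (C : VariableChange ℚ) (hC : C • V.quadraticTwist ((-1 : ℚ) ^ (p / 2) * p) = W)
    (hsplit : V.HasSplitMultiplicativeReductionAtPrime p) (hsurj : Surj W p)
    (hadd : Addv W p) (hrV : V.analyticRank = 0) (hrW : W.analyticRank = 0)
    {N : ℕ} [NeZero N] {f : CuspForm (Gamma0 N) 2} (hf : IsNewformOf V f)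
    (ϖ ϖ' : ℚ) (hϖ : (ϖ : ℝ) * V.realPeriodRat = plusPeriod f)
    (hϖ' : (ϖ' : ℝ) * V.imaginaryPeriodRat = minusPeriod f)
    (hO : (∏ i ∈ (Finset.Ico 1 (p - 1)).erase (p / 2),
        PowerSeries.constantCoeff
          (if Even i then padicLFunctionPlusBranchMult f (1 : ℚ_[p]) i
            else padicLFunctionMinusBranchMult f (1 : ℚ_[p]) i)) ≠ 0) :
    ∃ qV qW : ℚ, shaAn V = (qV : ℂ) ∧ shaAn W = (qW : ℂ) ∧
      (padicValNat p V.shaOrder : ℤ) + padicValNat p W.shaOrder +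
          (padicValNat p (V.baseChange (CyclotomicField p ℚ)).tamagawaProduct +
            2 * (padicValNat p (Nat.card V.toAffine.Point) + padicValNat p (Nat.card W.toAffine.Point))) ≤
        padicValRat p qV + padicValRat p qW +
          (padicValNat p V.tamagawaProduct + padicValNat p W.tamagawaProduct +
          2 * padicValNat p (Nat.card (V.baseChange (CyclotomicField p ℚ)).toAffine.Point) +
          (∏ i ∈ (Finset.Ico 1 (p - 1)).erase (p / 2),
              PowerSeries.constantCoeff
                (if Even i then padicLFunctionPlusBranchMult f (1 : ℚ_[p]) i
                  else padicLFunctionMinusBranchMult f (1 : ℚ_[p]) i)).valuation +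
          ((p / 2 : ℕ) : ℤ) * (padicValRat p ϖ + padicValRat p ϖ') - padicValRat p ϖ -
          (if p % 4 = 1 then padicValRat p ϖ else padicValRat p ϖ')) := by
  haveI : IsCyclotomicExtension {p} ℚ (CyclotomicField p ℚ) := CyclotomicField.isCyclotomicExtension p ℚ
  haveI : (V.baseChange (CyclotomicField p ℚ)).IsElliptic := by rw [baseChange]; infer_instance
  have hp2 : p ≠ 2 := by omega
  have hd : ((-1 : ℚ) ^ (p / 2) * p) ≠ 0 :=
    mul_ne_zero (pow_ne_zero _ (by norm_num)) (Nat.cast_ne_zero.mpr hp.out.ne_zero)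
  have hsurjV : ∀ n : ℕ, V.HasSurjectiveModNGaloisRep (p ^ n : ℕ) :=
    X4RankZeroTwistOdd.forall_surj_pow_twist_of_surj W p hp5 V hd C hC hsurj
  obtain ⟨Dq⟩ := (nonempty_tateParameterData_iff_holds (W := V) (p := p)).mpr hsplit
  obtain ⟨L, hL⟩ := exists_isSplitMultPAdicLFunctionOf (p := p) hsplit hf
  exact XSplitMultCyclotomicPrime.exists_padicVal_shaOrder_add_le_of_greenberg p V W hGr hGS hGZK hmod hp2
    C hC Dq hadd hrV hrW hf ϖ ϖ' hϖ hϖ' L hL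
    (fun κ γ hκ hγ hγ' D ↦ hK p V (CyclotomicField p ℚ) (V.baseChange (CyclotomicField p ℚ)) hp2 hsplit
      hsurjV ⟨1, one_smul _ _⟩ hκ hγ hγ' hf D ϖ ϖ' hϖ hϖ' L hL) hO

/-- **X4 (M), split twist: `BSD(W,p) ∧ BSD(V,p)` on the certified unit rows, from named facts only**
— the ADDITIVE X4 pair `(W,p)` (`I_n*`, `ρ̄_{W,p}` onto, `p ≥ 5`) and its SPLIT multiplicative twist
`(V,p)` simultaneously, granted Kato-as-attributed (split clause), Greenberg's split display,
Greenberg–Stevens, modularity, GZK, the unit bits and ONE numerical certificate (spending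
`ord_p ∏_w c_w(V_F)`). Census (this gen, `V19B-CENSUS.tsv`): 6 of the 10 CORE X4 (M)-rows at `p ≥ 5`
with split twist (`6300q1, 7050bh1, 9450ch1, 9450dh1, 18200s1, 19550bi1` at `p = 5`). Labels
UNCHANGED; nothing booked by this theorem.
[cite: Wuthrich2014, Thm. 3 (p. 383), Cor. 19 (pp. 398–399)] [cite: GreenbergLNM1716, §4 pp. 112–113]
[cite: Miller2011LMS, §1 and Def. 1.1] -/
theorem X4SplitMultCyclotomicPrime.bsdp_of_certificate_of_facts
    (hK : Wuthrich2014.kato_charIdeal_dvd_splitMultiplicative_cyclotomicPrime_of_surjective)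
    (hGr : Greenberg1999.thm41Analogue_charValue_rankZero_split_baseChange) (hGS : greenberg_stevens V p)
    (hGZK : rank_eq_analyticRank_of_analyticRank_le_one) (hmod : hasEntireLFunction_rat)
    (hp5 : 5 ≤ p) (C : VariableChange ℚ) (hC : C • V.quadraticTwist ((-1 : ℚ) ^ (p / 2) * p) = W)
    (hsplit : V.HasSplitMultiplicativeReductionAtPrime p) (hsurj : Surj W p)
    (hadd : Addv W p) (hrV : V.analyticRank = 0) (hrW : W.analyticRank = 0)
    {N : ℕ} [NeZero N] {f : CuspForm (Gamma0 N) 2} (hf : IsNewformOf V f)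
    (ϖ ϖ' : ℚ) (hϖ : (ϖ : ℝ) * V.realPeriodRat = plusPeriod f)
    (hϖ' : (ϖ' : ℝ) * V.imaginaryPeriodRat = minusPeriod f)
    (hO : (∏ i ∈ (Finset.Ico 1 (p - 1)).erase (p / 2),
        PowerSeries.constantCoeff
          (if Even i then padicLFunctionPlusBranchMult f (1 : ℚ_[p]) i
            else padicLFunctionMinusBranchMult f (1 : ℚ_[p]) i)) ≠ 0)
    (hcert : (padicValNat p V.tamagawaProduct : ℤ) + padicValNat p W.tamagawaProduct +
          2 * padicValNat p (Nat.card (V.baseChange (CyclotomicField p ℚ)).toAffine.Point) +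
          (∏ i ∈ (Finset.Ico 1 (p - 1)).erase (p / 2),
              PowerSeries.constantCoeff
                (if Even i then padicLFunctionPlusBranchMult f (1 : ℚ_[p]) i
                  else padicLFunctionMinusBranchMult f (1 : ℚ_[p]) i)).valuation +
          ((p / 2 : ℕ) : ℤ) * (padicValRat p ϖ + padicValRat p ϖ') - padicValRat p ϖ -
          (if p % 4 = 1 then padicValRat p ϖ else padicValRat p ϖ') ≤
        padicValNat p (V.baseChange (CyclotomicField p ℚ)).tamagawaProduct +
          2 * (padicValNat p (Nat.card V.toAffine.Point) + padicValNat p (Nat.card W.toAffine.Point)))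
    {qV qW : ℚ} (hqV : shaAn V = (qV : ℂ)) (hqW : shaAn W = (qW : ℂ))
    (hvV : padicValRat p qV = 0) (hvW : padicValRat p qW = 0) : BSDp W p ∧ BSDp V p :=
  XMultCyclotomicPrime.bsdp_of_ineq p V W hGZK hrV hrW
    (X4SplitMultCyclotomicPrime.exists_padicVal_shaOrder_add_le_of_facts p V W hK hGr hGS hGZK hmod hp5 C hC
      hsplit hsurj hadd hrV hrW hf ϖ ϖ' hϖ hϖ' hO) hcert hqV hqW hvV hvW

/-- **X4 (M), split twist: the typed UPPER half `ord_p #Ш(W) ≤ ord_p #Ш_an(W)`** from the same facts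
and certificate when `p ∤ #Ш_an(V)` (census: `15300s1, 16800i1` at `p = 5`, `#Ш_an(W) = 25`, bound `2`).
[cite: Wuthrich2014, Thm. 3 (p. 383), Cor. 19 (pp. 398–399)] [cite: GreenbergLNM1716, §4 pp. 112–113] -/
theorem X4SplitMultCyclotomicPrime.missingUpperBoundAt_of_certificate_of_facts
    (hK : Wuthrich2014.kato_charIdeal_dvd_splitMultiplicative_cyclotomicPrime_of_surjective)
    (hGr : Greenberg1999.thm41Analogue_charValue_rankZero_split_baseChange) (hGS : greenberg_stevens V p)
    (hGZK : rank_eq_analyticRank_of_analyticRank_le_one) (hmod : hasEntireLFunction_rat)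
    (hp5 : 5 ≤ p) (C : VariableChange ℚ) (hC : C • V.quadraticTwist ((-1 : ℚ) ^ (p / 2) * p) = W)
    (hsplit : V.HasSplitMultiplicativeReductionAtPrime p) (hsurj : Surj W p)
    (hadd : Addv W p) (hrV : V.analyticRank = 0) (hrW : W.analyticRank = 0)
    {N : ℕ} [NeZero N] {f : CuspForm (Gamma0 N) 2} (hf : IsNewformOf V f)
    (ϖ ϖ' : ℚ) (hϖ : (ϖ : ℝ) * V.realPeriodRat = plusPeriod f)
    (hϖ' : (ϖ' : ℝ) * V.imaginaryPeriodRat = minusPeriod f)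
    (hO : (∏ i ∈ (Finset.Ico 1 (p - 1)).erase (p / 2),
        PowerSeries.constantCoeff
          (if Even i then padicLFunctionPlusBranchMult f (1 : ℚ_[p]) i
            else padicLFunctionMinusBranchMult f (1 : ℚ_[p]) i)) ≠ 0)
    (hcert : (padicValNat p V.tamagawaProduct : ℤ) + padicValNat p W.tamagawaProduct +
          2 * padicValNat p (Nat.card (V.baseChange (CyclotomicField p ℚ)).toAffine.Point) +
          (∏ i ∈ (Finset.Ico 1 (p - 1)).erase (p / 2),
              PowerSeries.constantCoeff
                (if Even i then padicLFunctionPlusBranchMult f (1 : ℚ_[p]) i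
                  else padicLFunctionMinusBranchMult f (1 : ℚ_[p]) i)).valuation +
          ((p / 2 : ℕ) : ℤ) * (padicValRat p ϖ + padicValRat p ϖ') - padicValRat p ϖ -
          (if p % 4 = 1 then padicValRat p ϖ else padicValRat p ϖ') ≤
        padicValNat p (V.baseChange (CyclotomicField p ℚ)).tamagawaProduct +
          2 * (padicValNat p (Nat.card V.toAffine.Point) + padicValNat p (Nat.card W.toAffine.Point)))
    {qV : ℚ} (hqV : shaAn V = (qV : ℂ)) (hvV : padicValRat p qV ≤ 0) : MissingUpperBoundAt W p := by
  haveI : Finite V.sha := (hGZK V (by rw [hrV]; exact zero_le_one)).2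
  exact XMultCyclotomicPrime.missingUpperBoundAt_of_ineq p V W
    (X4SplitMultCyclotomicPrime.exists_padicVal_shaOrder_add_le_of_facts p V W hK hGr hGS hGZK hmod hp5 C hC
      hsplit hsurj hadd hrV hrW hf ϖ ϖ' hϖ hϖ' hO) hcert hqV hvV

/-- **X4 (M), split twist, `p ∣ #Ш_an(W)` rows: `BSD(W,p)`** from the same facts and certificate,
`p ∤ #Ш_an(V)`, Cassels–Tate (`hCT`) and ONE `p`-descent certificate `p^{2k−1} ∣ #Ш(W)`,
`ord_p #Ш_an(W) ≤ 2k` (census: `15300s1, 16800i1` close with one `5`-descent certificate each).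
[cite: Wuthrich2014, Thm. 3 (p. 383), Cor. 19 (pp. 398–399)] [cite: SilvermanAEC2009, Thm. X.4.14] -/
theorem X4SplitMultCyclotomicPrime.bsdp_of_casselsTate_of_certificate_of_facts
    (hK : Wuthrich2014.kato_charIdeal_dvd_splitMultiplicative_cyclotomicPrime_of_surjective)
    (hGr : Greenberg1999.thm41Analogue_charValue_rankZero_split_baseChange) (hGS : greenberg_stevens V p)
    (hGZK : rank_eq_analyticRank_of_analyticRank_le_one) (hmod : hasEntireLFunction_rat)
    (hCT : exists_casselsTate_pairing (K := ℚ))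
    (hp5 : 5 ≤ p) (C : VariableChange ℚ) (hC : C • V.quadraticTwist ((-1 : ℚ) ^ (p / 2) * p) = W)
    (hsplit : V.HasSplitMultiplicativeReductionAtPrime p) (hsurj : Surj W p)
    (hadd : Addv W p) (hrV : V.analyticRank = 0) (hrW : W.analyticRank = 0)
    {N : ℕ} [NeZero N] {f : CuspForm (Gamma0 N) 2} (hf : IsNewformOf V f)
    (ϖ ϖ' : ℚ) (hϖ : (ϖ : ℝ) * V.realPeriodRat = plusPeriod f)
    (hϖ' : (ϖ' : ℝ) * V.imaginaryPeriodRat = minusPeriod f)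
    (hO : (∏ i ∈ (Finset.Ico 1 (p - 1)).erase (p / 2),
        PowerSeries.constantCoeff
          (if Even i then padicLFunctionPlusBranchMult f (1 : ℚ_[p]) i
            else padicLFunctionMinusBranchMult f (1 : ℚ_[p]) i)) ≠ 0)
    (hcert : (padicValNat p V.tamagawaProduct : ℤ) + padicValNat p W.tamagawaProduct +
          2 * padicValNat p (Nat.card (V.baseChange (CyclotomicField p ℚ)).toAffine.Point) +
          (∏ i ∈ (Finset.Ico 1 (p - 1)).erase (p / 2),
              PowerSeries.constantCoeff
                (if Even i then padicLFunctionPlusBranchMult f (1 : ℚ_[p]) i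
                  else padicLFunctionMinusBranchMult f (1 : ℚ_[p]) i)).valuation +
          ((p / 2 : ℕ) : ℤ) * (padicValRat p ϖ + padicValRat p ϖ') - padicValRat p ϖ -
          (if p % 4 = 1 then padicValRat p ϖ else padicValRat p ϖ') ≤
        padicValNat p (V.baseChange (CyclotomicField p ℚ)).tamagawaProduct +
          2 * (padicValNat p (Nat.card V.toAffine.Point) + padicValNat p (Nat.card W.toAffine.Point)))
    {qV : ℚ} (hqV : shaAn V = (qV : ℂ)) (hvV : padicValRat p qV ≤ 0)
    {q : ℚ} (hq : shaAn W = (q : ℂ)) {k : ℕ} (hv : padicValRat p q ≤ 2 * k)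
    (hdvd : p ^ (2 * k - 1) ∣ W.shaOrder) : BSDp W p :=
  XMultCyclotomicPrime.bsdp_of_casselsTate_of_ineq p V W hGZK hCT hrV hrW
    (X4SplitMultCyclotomicPrime.exists_padicVal_shaOrder_add_le_of_facts p V W hK hGr hGS hGZK hmod hp5 C hC
      hsplit hsurj hadd hrV hrW hf ϖ ϖ' hϖ hϖ' hO) hcert hqV hvV hq hv hdvd

end Split

end Summit.BirchSwinnertonDyer.Rank1Residual.Additive

end
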